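import Summits.CriticalPhenomena.SAWScalingLimit.Theorems.SAWLoopFugacityFlowSimpleSubseqLimitsRouteResidual
import Summits.CriticalPhenomena.SAWScalingLimit.Theorems.SAWLoopFugacityFlowSimpleSubseqLimitsBoundaryCore
import HarnessLib.Audit

/-!
# Line `past-shadowing-costs-halves`, reshaping v4 (lead c4, 2026-08-17): BOUNDARY AVOIDANCE, TWICE
# — skeleton of the A-side-free lattice line for the crux `SimpleSubseqLimits` (stmt-CriticalPhenomena-4982)

v3 (lead c3) closed the crux from `FirstHitDecay ∧ BoundaryDecay`.  v4 replaces the ORDER input by the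
WEAKER and mechanism-faithful `FarReturnDecay` (first-entrance slit avoidance): after its first entrance
into `B̄(q, r')` the walk does not come back `ε`-close to the part of its past traversed before it met
the guard ball `B̄(q, 5r)` — a ONE-STOPPING-TIME past/future event (`FarPast.Passage.nearFarReturn_pastFuture`),
i.e. exactly what the exact domain Markov property turns into "the critical SAW of the slit graph avoids
the far part of the slit".  The closing needs only such far returns (guarded Rohde–Schramm,
`FirstHitFlatGuard`, p132689).  Both inputs are now AVOIDANCE statements of the same kind: avoid `∂Ω`
(`BoundaryDecay`), avoid the own past at first entrances (`FarReturnDecay`).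

Sorries: exactly the research-open inputs —
* `stub_farReturnDecay : FarReturnDecay` — OPEN (ORDER; vocabulary + passage `FarPast.Passage`, pins in
  `FarPast.Line`: `FirstHitDecay ⇒` it, summit ⇒ it, `EventualTight ∧ crux ⇒` it);
* `stub_boundaryDecay : BoundaryDecay` — OPEN (BOUNDARY; `Boundary.Passage`, pins in `Boundary.Line`);
* `stub_firstHitDecay : FirstHitDecay` — OPEN, the stronger v3 ORDER input (kept registered; it implies
  `stub_farReturnDecay` by `FarPast.Line.farReturnDecay_of_firstHitDecay`);
* `stub_pastFutureAvoidance : PastFutureAvoidance` — OPEN, the CLEANEST ORDER input (polyline-level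
  past/future return at first entrances; implies `stub_farReturnDecay`, pinned: `FarPast.Pinned`);
everything else is a tree theorem (landed stubs below), and
`SimpleSubseqLimits_of stub_farReturnDecay stub_boundaryDecay` = `FarPast.Line.line_farReturn` concludes the
crux BY NAME with NO route item.  Residual certificate (landed, `FarPast.Line.crux_iff_farLattice`):
`EventualTight → (SimpleSubseqLimits ↔ FarReturnDecay ∧ BoundaryDecay)`; promotable self-contained item
`FarPast.Line.LatticeAvoidance` (`latticeAvoidance_iff := Iff.rfl`), weaker than v3's `Boundary.Line.LatticeInputs`.

Lead c5 (2026-08-17), no reshaping of the stubs; three landed additions around them: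
* INSIDE THE ROUTES the residual is `stub_pastFutureAvoidance` ALONE — `FarPast.RouteResidual` (p138437/p138587):
  `line_pastFuture_avoidanceLimit : PastFutureAvoidance → AvoidanceLimit → SimpleSubseqLimits` (no tightness;
  the A-side supports discharged by their tree proofs), `stub_routeResidual : EventualTight → AvoidanceLimit →
  (SimpleSubseqLimits ↔ PastFutureAvoidance)`, `sawScalingLimit_of_three_inputs : AvoidanceLimit →
  PastFutureAvoidance → EventualTight → SAWScalingLimit`; composition `SimpleSubseqLimits_ofRoute` below;
* EXPONENT INTERFACE — `FarPast.Exponent` (`…TwoStrandExponent.lean` p139195, `…NearDoublePoint.lean`):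
  `stub_exponentInterface : LocalReturnDecay → PastFutureAvoidance` (sub-area one-point bound on localised
  first-entrance returns, e.g. any `C ρ^{2+c}`), `stub_nearDoublePointInterface : NearDoublePointBound →
  PastFutureAvoidance` (stopping-time-free: `P_δ[z is a (ρ,R)-near double point] ≤ θ ρ²`) — quantitative
  lattice statements STRONGER than the residual, through which an exponent result would close the crux;
* paste-ready restatement text `Cruxes/SimpleSubseqLimits/Lines/pfa_route_vocab.lean`.
-/

noncomputable section

open MeasureTheory Filter Topology Set Metric Function
open Literature.Probability.RandomPlanarGeometry Literature.Probability.RandomPlanarGeometry.SAW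
open Literature.Probability.LatticeModels
open scoped ENNReal NNReal BoundedContinuousFunction unitInterval

namespace Summit.CriticalPhenomena.SAWScalingLimit.Cruxes.SimpleSubseqLimits.FarReturnAvoidance

open Summit.CriticalPhenomena.SAWScalingLimit.Theses.SAWLoopFugacityFlow (SimpleSubseqLimits)
open Summit.CriticalPhenomena.SAWScalingLimit.Theorems.SimpleSubseqLimits.MarkedPointRevisit.Passage
  (IsSubseqLimit)
open Summit.CriticalPhenomena.SAWScalingLimit.Theorems.SimpleSubseqLimits.FirstHit.Passage (FirstHitDecay)
open Summit.CriticalPhenomena.SAWScalingLimit.Theorems.SimpleSubseqLimits.Boundary.Passage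
  (BoundaryDecayAt BoundaryDecay)
open Summit.CriticalPhenomena.SAWScalingLimit.Theorems.SimpleSubseqLimits.Boundary
open Summit.CriticalPhenomena.SAWScalingLimit.Theorems.SimpleSubseqLimits.FarPast.Passage
  (FarReturnDecayAt FarReturnDecay)
open Summit.CriticalPhenomena.SAWScalingLimit.Theorems.SimpleSubseqLimits.FarPast.Line
  (line_farReturn farReturnDecay_of_firstHitDecay PastFutureAvoidance
    farReturnDecay_of_pastFutureAvoidance)
open Summit.CriticalPhenomena.SAWScalingLimit.Theorems.SimpleSubseqLimits

/-! ## The open stubs -/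

/-- **stub 1 — FAR-RETURN DECAY** (OPEN lattice input, ORDER as first-entrance slit avoidance). -/
theorem stub_farReturnDecay : FarReturnDecay := by
  sorry

/-- **stub 2 — BOUNDARY DECAY** (OPEN lattice input, BOUNDARY). -/
theorem stub_boundaryDecay : BoundaryDecay := by
  sorry

/-- **stub 1′ — FIRST-HIT RETURN DECAY** (OPEN; the stronger v3 ORDER input, implies stub 1). -/
theorem stub_firstHitDecay : FirstHitDecay := by
  sorry

/-- **stub 1″ — PAST/FUTURE AVOIDANCE AT FIRST ENTRANCES** (OPEN; the cleanest ORDER input, the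
polyline event the exact domain Markov property acts on; implies stub 1, and is equivalent to it
modulo `EventualTight ∧ BoundaryDecay`, `FarPast.Pinned.pastFuture_iff_farReturn`). -/
theorem stub_pastFutureAvoidance : PastFutureAvoidance := by
  sorry

/-! ## The landed stubs (tree theorems) -/

/-- **stub 3 — guarded Rohde–Schramm closing lemma** (LANDED p132689, `FirstHitFlatGuard`). -/
theorem firstHit_closedBall_guard_simple : ∀ (γ : Curve ℂ) (S : Set ℂ), Dense S → (∀ q ∈ S, ∀ r : ℚ, 0 < r → ∀ t : I, γ t ∈ closedBall q (r : ℝ) → (∀ v : I, v < t → γ v ∉ closedBall q (r : ℝ)) → ∀ v u : I, v < t → t ≤ u → (∀ w : I, w ≤ v → 5 * (r : ℝ) < dist (γ w) q) → γ u ≠ γ v) → γ 0 ≠ γ 1 → CurveClass.mk γ ∈ CurveClass.simple :=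
  FirstHitFlatGuard.firstHit_closedBall_guard_simple

/-- **stub 4 — limit passage + closing of the far-return typing** (LANDED, `FarPast.Passage`). -/
theorem stub_farReturnPassage : ∀ (D : DobrushinDomain) (a b : ℝ → Site 2) (s : ℕ → ℝ) (ν : Measure (CurveClass ℂ)), SAW.IsEndpointApprox D a b → FarReturnDecayAt D a b → IsSubseqLimit D a b s ν → ∀ᵐ c ∂ν, c ∈ CurveClass.simple :=
  FarPast.Passage.stub_farReturnPassage

/-- **stub 5 — the v4 line with its pins** (LANDED, `FarPast.Line`). -/
theorem stub_farReturnLine : FarReturnDecay → BoundaryDecay → SimpleSubseqLimits :=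
  FarPast.Line.stub_farReturnLine

/- stub 5′ — the residual certificate, cleanest form: LANDED as
`FarPast.Pinned.stub_pastFuturePinned : EventualTight → (SimpleSubseqLimits ↔ PastFutureAvoidance ∧ BoundaryDecay)`
(p133907, `Theorems/SAWLoopFugacityFlowSimpleSubseqLimitsPastFuturePinned.lean`; not imported here only to keep the
skeleton checkable while the farm builds that module). -/

/-- **stub 6 — openness of the thickened near-boundary-visit configuration** (LANDED p131382, c3). -/
theorem stub_boundaryOpen : ∀ (D : DobrushinDomain) (ρ ε : ℝ), IsOpen {γ : Curve ℂ | ∃ t : I, Metric.infDist (γ t) (frontier D.carrier) < ε ∧ ρ < dist (γ t) (D.pt 0) ∧ ρ < dist (γ t) (D.pt 1)} :=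
  Passage.stub_boundaryOpen

/-- **stub 7 — core of the boundary pins** (LANDED p131357, c3's worker). -/
theorem stub_boundaryCore : ∀ (D : DobrushinDomain) (ρ : ℝ) (c : CurveClass ℂ), 0 < ρ → (∀ n : ℕ, c ∈ closure {c' : CurveClass ℂ | ∃ γ : Curve ℂ, CurveClass.mk γ = c' ∧ ∃ t : I, Metric.infDist (γ t) (frontier D.carrier) < 1 / ((n : ℝ) + 1) ∧ ρ < dist (γ t) (D.pt 0) ∧ ρ < dist (γ t) (D.pt 1)}) → ∃ x ∈ c.range, x ∈ frontier D.carrier ∧ ρ ≤ dist x (D.pt 0) ∧ ρ ≤ dist x (D.pt 1) :=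
  Core.stub_boundaryCore

/-- **stub 8 — limit passage of the boundary typing** (LANDED p131382, c3). -/
theorem stub_boundaryPassage : ∀ (D : DobrushinDomain) (a b : ℝ → Site 2) (s : ℕ → ℝ) (ν : Measure (CurveClass ℂ)), BoundaryDecayAt D a b → IsSubseqLimit D a b s ν → ∀ᵐ c ∂ν, c.range ∩ frontier D.carrier ⊆ {D.pt 0, D.pt 1} :=
  Passage.stub_boundaryPassage

/-! ## Name-keyed aliases and the composition -/

namespace Registered

/-- Alias keyed by the stub name. -/
abbrev stub_farReturnDecay : Prop := FarReturnDecay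
/-- Alias keyed by the stub name. -/
abbrev stub_boundaryDecay : Prop := BoundaryDecay
/-- Alias keyed by the stub name (the stronger v3 ORDER input). -/
abbrev stub_firstHitDecay : Prop := FirstHitDecay
/-- Alias keyed by the stub name (the cleanest ORDER input). -/
abbrev stub_pastFutureAvoidance : Prop := PastFutureAvoidance

end Registered

/-- **The line concludes the crux BY NAME from the two avoidance inputs alone** (verbatim the LANDED
`FarPast.Line.line_farReturn`): `ν`-a.s. simple from the far-return input (guarded Rohde–Schramm one
level down), the boundary clause from the boundary input, endpoints and confinement free. No route item. -/
theorem SimpleSubseqLimits_of (hF : Registered.stub_farReturnDecay) (hB : Registered.stub_boundaryDecay) :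
    Summit.CriticalPhenomena.SAWScalingLimit.Theses.SAWLoopFugacityFlow.SimpleSubseqLimits :=
  line_farReturn hF hB

/-- The v3 composition factors through v4: the stronger first-hit input also closes the crux. -/
theorem SimpleSubseqLimits_of' (hF : Registered.stub_firstHitDecay) (hB : Registered.stub_boundaryDecay) :
    Summit.CriticalPhenomena.SAWScalingLimit.Theses.SAWLoopFugacityFlow.SimpleSubseqLimits :=
  SimpleSubseqLimits_of (farReturnDecay_of_firstHitDecay hF) hB

/-- The cleanest composition: past/future avoidance at first entrances + boundary decay. -/
theorem SimpleSubseqLimits_of'' (hP : Registered.stub_pastFutureAvoidance)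
    (hB : Registered.stub_boundaryDecay) :
    Summit.CriticalPhenomena.SAWScalingLimit.Theses.SAWLoopFugacityFlow.SimpleSubseqLimits :=
  SimpleSubseqLimits_of (farReturnDecay_of_pastFutureAvoidance hP) hB

/-- **Inside the routes** (lead c5): the crux from the cleanest ORDER stub and the A-side crux
`AvoidanceLimit` (stmt-10649) alone — no boundary stub, no tightness (`FarPast.RouteResidual`). -/
theorem SimpleSubseqLimits_ofRoute (hP : Registered.stub_pastFutureAvoidance)
    (hA : Summit.CriticalPhenomena.SAWScalingLimit.Theses.SAWLoopFugacityFlow.AvoidanceLimit) :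
    Summit.CriticalPhenomena.SAWScalingLimit.Theses.SAWLoopFugacityFlow.SimpleSubseqLimits :=
  FarPast.RouteResidual.line_pastFuture_avoidanceLimit hP hA

/-- Wiring check: the crux from the registered open stubs (v4). -/
theorem SimpleSubseqLimits_proof :
    Summit.CriticalPhenomena.SAWScalingLimit.Theses.SAWLoopFugacityFlow.SimpleSubseqLimits :=
  SimpleSubseqLimits_of stub_farReturnDecay stub_boundaryDecay

/-- Wiring check: the crux from the v3 open stubs. -/
theorem SimpleSubseqLimits_proof' :
    Summit.CriticalPhenomena.SAWScalingLimit.Theses.SAWLoopFugacityFlow.SimpleSubseqLimits :=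
  SimpleSubseqLimits_of' stub_firstHitDecay stub_boundaryDecay

/-- Wiring check: the crux from the cleanest open stubs. -/
theorem SimpleSubseqLimits_proof'' :
    Summit.CriticalPhenomena.SAWScalingLimit.Theses.SAWLoopFugacityFlow.SimpleSubseqLimits :=
  SimpleSubseqLimits_of'' stub_pastFutureAvoidance stub_boundaryDecay

end Summit.CriticalPhenomena.SAWScalingLimit.Cruxes.SimpleSubseqLimits.FarReturnAvoidance

end
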